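import Summits.QuantumFields.YangMills.Theorems.BalabanUVNodesN19HybridBeyondTarget

/-!
# YM-DAG node N19 (= NE7 proper) — NODE U5's `Target` WITHOUT A CLASS-UNIFORM CONSTANT: the RESPONSE-MATCHING ∕ DECORRELATION road.
# `MatchingModConstants` for the totals follows from (RM) per-class two-run matching of the SOURCE RESPONSES (= `Core` with CLASS-DEPENDENT
# constants) and (DC) one DECORRELATION letter — under run A's source-free class law the two-run vacuum CONTRAST and run A's source RESPONSE
# have uncorrelated means; (DC) is implied by a class-blind response, by a class-blind contrast (the `Core` road), and EXACTLY by an old∕recent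
# product structure — so an EXTENSIVE, law-separating old-block contrast (crux card window-key-core) does NOT by itself obstruct the node's target

Cell `pub-ymgap`, HUMAN RULING D-0062 (Track A), width seat `pub-ymgap-dag-n19-w2` (node n19 = NE7), generation g7 (explicit-unit brief «take a
sub-lemma no sibling holds», R455 (A) rule (ii) self-located piece; CLAIM-2 on the cell bus).  Route `Summits/QuantumFields/YangMills/Theses/BalabanUVNodes.lean`,
key item K3⁸ `SpineGivenEndpointR13SepCoPHV` (stmt-QuantumFields-27366; aside predecessor K3⁷ 20544); filed `--kind proof --supports … --as helper`.
COUNT-NEUTRAL.  THEOREMS ONLY (0 `def`, 0 `instance`, 0 `sorry`).  ADDITIVE — imports dag-n19-w1's `…N19HybridBeyondTarget` (p602850; through it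
dag-n19-e's `…N19CoreMetric` and `Spine/NE7/Targets`, `T4CauchySum`): `N19CoreMetric.matchingModConstants_of_genFun_increments`,
`NE7.sandwich_of_abs_log_sub_le`, `NE7.Target`, `genFun` BY NAME; modifies nothing.

WHY.  Node U5's DECL target is `Spine.NE7.Target vol l₀ δ Z := MatchingModConstants vol l₀ δ Z ∧ Summable δ` — a statement about the dressed PARTITION
FUNCTIONS `Z K t = Σ_T A K t`, `Z (K+1) t = Σ_T B K t`.  The road the spine chose (K3 stub 2's N19′ face) is `NE7.Core`: ONE constant `c_K` uniform over
the good classes.  The tree knows the converse fails (dag-n19-e `…N19SourceSplitGuards`, dag-n19-w1 g0 `exists_totalCore_not_core`) and EXACTLY by how much: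
GIVEN the weights, `HybridNE7 ⟺ Target ∧ Hom` with `Hom` the summable CLASS-OSCILLATION of `log B − log A` (dag-n19-w1 `hybridNE7Edge_iff_target_classOsc`);
and the crux card `Cruxes/SpineGivenEndpointR13SepCoPH/Ideas/window-key-core.md` locates where `Hom` (hence `Core`) FAILS at the pinned key: the two-run
contrast of the OLD large-field block factors is additive in the class's old-block count, `≈ n_K(τ)·D₀`, `D₀ ≠ 0` — extensive, class-law separating, no
dial rescues (ed. 2).  QUESTION this file answers in kernel form: does that obstruction touch the node's TARGET, or only the `Core` ROAD?  ONLY THE ROAD —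
provided one DECORRELATION letter holds.  Write `ρ_t(τ) := A_t(τ)∕A_0(τ)` (run A's source RESPONSE of class `τ`) and `e^{h_0(τ)} := B_0(τ)∕A_0(τ)` (the
two-run source-free CONTRAST).  Then `Z_B(t)∕Z_B(0) = E_{ν_B}[B_t∕B_0]`, `Z_A(t)∕Z_A(0) = E_{ν_A}[ρ_t]` with `ν_X ∝ X_0` the source-free class laws, and
`ν_B = ν_A` TILTED by `e^{h_0}`.  So the generating-function increments of the two runs agree as soon as
  (RM) `B_t∕B_0 = ρ_t·e^{±r}` class by class — TWO-RUN MATCHING OF THE RESPONSES = `Core` for the `t`-increments = `Core` with the CLASS-DEPENDENT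
       canonical constants `c_{K,τ} = h_0(τ)` (weaker than `Core`; the T4 design's term-wise matching in increment form), and
  (DC) `E_{ν_A}[e^{h_0}ρ_t]∕E_{ν_A}[e^{h_0}] = E_{ν_A}[ρ_t]·e^{±κ}` — the contrast and the response are (multiplicatively) UNCORRELATED under `ν_A`.
(DC) holds with `κ = 2s` if the response is CLASS-BLIND up to `s` (`ρ_t(τ) = e^{φ(t) ± s}`: run A's class law does not feel the source), with `κ = 2η` if the
contrast is class-blind up to `η` (`h_0(τ) = c ± η`: the `Core` road), and with `κ = 0` EXACTLY when the classes factor as (old coordinate) × (recent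
coordinate), `ν_A` is a product, the contrast reads the old coordinate only and the response the recent one only — however large and law-separating the
contrast.  So at a key where the two-run contrast sits on OLD structure and the loop's response on RECENT∕near-loop structure, the node's target asks
the two to DECORRELATE under the class law (an aging∕locality statement), not the contrast to vanish.

WHAT IS KERNEL-CHECKED ([folklore] finite sums, `Real.log`∕`Real.exp`; the tree's lemmas BY NAME).
* §1 ONE `(K)`, all classes good — `abs_genFunIncr_sub_le_of_response_decorrelation` (+ NECESSITY `abs_decorrelation_le_of_genFunIncr`: GIVEN (RM), the
  increment bound and (DC) are within `r` of each other — with exact response matching node U5's increment bound IS the decorrelation letter): positive class weights `A_t, B_t` on a finite class set `T` for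
  `|t| ≤ l₀` (`0 ≤ l₀`), (RM) with radius `r`, (DC) with radius `κ` (both DISPLAYED as finite-sum inequalities, no `def`) ⇒
  `|(log Σ_T B_t − log Σ_T B_0) − (log Σ_T A_t − log Σ_T A_0)| ≤ r + κ`.
* §2 THE THREE SOURCES OF (DC): `decorrelation_of_classBlindResponse` (`κ = 2s`) · `decorrelation_of_classBlindContrast` (`κ = 2η` — the `Core` road's
  constant) · `decorrelation_of_product` (`κ = 0` EXACTLY: `T = T₁ ×ˢ T₂`, `A_0 = a₁ ⊗ a₂`, contrast on the first factor, response on the second).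
* §3 ALONG `K` — `matchingModConstants_of_responseDecorrelationReading` ∕ `target_of_responseDecorrelationReading`: ONE sequence `Z` READ through the
  dictionary `Z K t = Σ_{T K} A K t`, `Z (K+1) t = Σ_{T K} B K t` on `|t| ≤ l₀`, (RM)_K + (DC)_K with `r_K + κ_K ≤ vol·δ_K` ⇒ `MatchingModConstants vol l₀ δ Z`
  with the CANONICAL constants (`N19CoreMetric.matchingModConstants_of_genFun_increments` BY NAME); `Summable δ` ⇒ `NE7.Target vol l₀ δ Z`.
* THE WITNESS («`Target ∧ ¬Core-edge` at one reading», two law-separated classes with identical responses) and the hybrid (bad-class) edition are the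
  companion file `…N19TargetOfDecorrelationReadingWitness` (imports this one).

WHAT THIS DOES NOT DO ∕ HONEST FRAMING.  (RM), (DC), class-blindness, the product structure are HYPOTHESIS SHAPES on positive finite class weights,
produced by nobody for Bałaban's runs; whether the spine reading of record decorrelates old contrast from loop response is an (unprinted) aging∕locality
question for the n19∕n20∕NODE-O lanes and the crux cards, NOT answered here; K3's registered stub 2 is typed on the `Core` road and is NOT served by §3
(a `Target`-level face would need a re-line by the planner — said, not asked); bad classes ∕ shells are not displayed in this file (all classes good —
the hybrid split composes with §1 through dag-n20-w4's class-law budget files, not re-derived).  ZERO Bałaban content; NE7 ∕ NE7b ∕ NE7c NOT PRINTED for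
d = 4 ∕ NOT proved; N19 ∕ N20 NOT discharged; K3⁸ 27366 OPEN («v6» pending registration), K3⁷ 20544 aside, neither claimed; counts UNMOVED (typed 28∕28 ·
discharged 5∕27, A 5∕28); no count claim.  One finite four-torus programme at fixed ε, Bałaban AS PRINTED; R4 closes the conditional finite-𝕋⁴ rung
`BalabanLadder.UV` only — NOT infinite volume, NOT OS on ℝ⁴, NOT the Yang–Mills mass gap, NOT the Clay problem.  0 `def`; 0 `sorry`; standard axioms.
-/

noncomputable section

open Finset Filter
open scoped BigOperators

namespace Summit.QuantumFields.YangMills.BalabanUVNodes.N19TargetOfDecorrelationReading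

open Literature.MathematicalPhysics.QuantumFieldTheory.Balaban1983to89
open Literature.MathematicalPhysics.QuantumFieldTheory.Balaban1983to89.T4CauchySum (MatchingModConstants genFun)
open Summit.QuantumFields.BalabanUV.T4Continuum.Spine
open Summit.QuantumFields.YangMills.BalabanUVNodes.N19CoreMetric (matchingModConstants_of_genFun_increments)

variable {ι : Type*}

/-! ## §0 Two elementary sandwiches -/

/-- A finite sum of positive terms each sandwiched `e^{−r}·x ≤ y ≤ e^{r}·x` is sandwiched the same way. [folklore] -/
theorem sum_sandwich {T : Finset ι} {x y : ι → ℝ} {r : ℝ}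
    (h : ∀ τ ∈ T, Real.exp (-r) * x τ ≤ y τ ∧ y τ ≤ Real.exp r * x τ) :
    Real.exp (-r) * ∑ τ ∈ T, x τ ≤ ∑ τ ∈ T, y τ ∧ ∑ τ ∈ T, y τ ≤ Real.exp r * ∑ τ ∈ T, x τ := by
  constructor
  · rw [Finset.mul_sum]; exact Finset.sum_le_sum fun τ hτ => (h τ hτ).1
  · rw [Finset.mul_sum]; exact Finset.sum_le_sum fun τ hτ => (h τ hτ).2

/-- From a positive sandwich `e^{−r}·X ≤ Y ≤ e^{r}·X` (`X > 0`) to `|log Y − log X| ≤ r`. [folklore] -/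
theorem abs_log_sub_log_le_of_sandwich {X Y r : ℝ} (hX : 0 < X) (h : Real.exp (-r) * X ≤ Y ∧ Y ≤ Real.exp r * X) :
    |Real.log Y - Real.log X| ≤ r := by
  have hY : 0 < Y := lt_of_lt_of_le (mul_pos (Real.exp_pos _) hX) h.1
  rw [abs_le]
  constructor
  · have := Real.log_le_log (mul_pos (Real.exp_pos _) hX) h.1
    rw [Real.log_mul (Real.exp_pos _).ne' hX.ne', Real.log_exp] at this
    linarith
  · have := Real.log_le_log hY h.2
    rw [Real.log_mul (Real.exp_pos _).ne' hX.ne', Real.log_exp] at this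
    linarith

/-- From `|log y − log x| ≤ r` with `x, y > 0` to the sandwich `e^{−r}·x ≤ y ≤ e^{r}·x` (`NE7.sandwich_of_abs_log_sub_le` at `c = 0`). [folklore] -/
theorem sandwich_of_abs_log_sub_log_le {x y r : ℝ} (hx : 0 < x) (hy : 0 < y) (h : |Real.log y - Real.log x| ≤ r) :
    Real.exp (-r) * x ≤ y ∧ y ≤ Real.exp r * x := by
  have h' : |Real.log y - Real.log x - 0| ≤ r := by simpa using h
  have := NE7.sandwich_of_abs_log_sub_le hx hy h'
  simpa only [zero_sub, zero_add] using this

/-! ## §1 ONE `K`, all classes good: response matching + decorrelation ⇒ the generating-function increments agree -/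

section OneStep

variable {T : Finset ι} {A B : ℝ → ι → ℝ} {l₀ r κ : ℝ}

/-- **THE RESPONSE-MATCHING ∕ DECORRELATION BOUND AT ONE STEP.**  Positive class weights `A t τ`, `B t τ` (`τ ∈ T`, `|t| ≤ l₀`, `0 ≤ l₀`) with
(RM) `|(log B_t τ − log B_0 τ) − (log A_t τ − log A_0 τ)| ≤ r` on every class — two-run matching of the source RESPONSES, i.e. `Core` for the increments
with the CLASS-DEPENDENT constants `log B_0 τ − log A_0 τ` — and (DC) `|log(Σ_T B_0·A_t∕A_0) − log(Σ_T B_0) − (log Σ_T A_t − log Σ_T A_0)| ≤ κ` — the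
`ν_B`-mean and the `ν_A`-mean of run A's response `A_t∕A_0` agree (`ν_X ∝ X_0`; equivalently the contrast `B_0∕A_0` and the response are uncorrelated
under `ν_A` up to `e^{±κ}`) ⇒ `|(log Σ_T B_t − log Σ_T B_0) − (log Σ_T A_t − log Σ_T A_0)| ≤ r + κ`.  No class-uniform constant anywhere. [folklore] -/
theorem abs_genFunIncr_sub_le_of_response_decorrelation (hT : T.Nonempty)
    (hA : ∀ t, |t| ≤ l₀ → ∀ τ ∈ T, 0 < A t τ) (hB : ∀ t, |t| ≤ l₀ → ∀ τ ∈ T, 0 < B t τ) (hl₀ : 0 ≤ l₀)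
    (hRM : ∀ t, |t| ≤ l₀ → ∀ τ ∈ T,
      |(Real.log (B t τ) - Real.log (B 0 τ)) - (Real.log (A t τ) - Real.log (A 0 τ))| ≤ r)
    (hDC : ∀ t, |t| ≤ l₀ →
      |Real.log (∑ τ ∈ T, B 0 τ * (A t τ / A 0 τ)) - Real.log (∑ τ ∈ T, B 0 τ) -
        (Real.log (∑ τ ∈ T, A t τ) - Real.log (∑ τ ∈ T, A 0 τ))| ≤ κ)
    {t : ℝ} (ht : |t| ≤ l₀) :
    |(Real.log (∑ τ ∈ T, B t τ) - Real.log (∑ τ ∈ T, B 0 τ)) -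
        (Real.log (∑ τ ∈ T, A t τ) - Real.log (∑ τ ∈ T, A 0 τ))| ≤ r + κ := by
  have h0 : |(0 : ℝ)| ≤ l₀ := by simpa using hl₀
  -- the tilted response sum `S = Σ B_0 · A_t/A_0`
  set S : ℝ := ∑ τ ∈ T, B 0 τ * (A t τ / A 0 τ) with hS
  have hXpos : ∀ τ ∈ T, 0 < B 0 τ * (A t τ / A 0 τ) := fun τ hτ =>
    mul_pos (hB 0 h0 τ hτ) (div_pos (hA t ht τ hτ) (hA 0 h0 τ hτ))
  have hSpos : 0 < S := Finset.sum_pos hXpos hT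
  -- (RM) term by term: `e^{-r} · (B_0 A_t/A_0) ≤ B_t ≤ e^{r} · (B_0 A_t/A_0)`
  have hterm : ∀ τ ∈ T, Real.exp (-r) * (B 0 τ * (A t τ / A 0 τ)) ≤ B t τ ∧ B t τ ≤ Real.exp r * (B 0 τ * (A t τ / A 0 τ)) := by
    intro τ hτ
    refine sandwich_of_abs_log_sub_log_le (hXpos τ hτ) (hB t ht τ hτ) ?_
    have hlogX : Real.log (B 0 τ * (A t τ / A 0 τ)) = Real.log (B 0 τ) + (Real.log (A t τ) - Real.log (A 0 τ)) := by
      rw [Real.log_mul (hB 0 h0 τ hτ).ne' (div_pos (hA t ht τ hτ) (hA 0 h0 τ hτ)).ne',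
        Real.log_div (hA t ht τ hτ).ne' (hA 0 h0 τ hτ).ne']
    rw [hlogX]
    have := hRM t ht τ hτ
    have e : Real.log (B t τ) - (Real.log (B 0 τ) + (Real.log (A t τ) - Real.log (A 0 τ))) =
        Real.log (B t τ) - Real.log (B 0 τ) - (Real.log (A t τ) - Real.log (A 0 τ)) := by ring
    rwa [e]
  have hsum := sum_sandwich hterm
  have hlogB : |Real.log (∑ τ ∈ T, B t τ) - Real.log S| ≤ r := abs_log_sub_log_le_of_sandwich hSpos hsum
  have hdc := hDC t ht
  -- combine
  have e : Real.log (∑ τ ∈ T, B t τ) - Real.log (∑ τ ∈ T, B 0 τ) - (Real.log (∑ τ ∈ T, A t τ) - Real.log (∑ τ ∈ T, A 0 τ)) =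
      (Real.log (∑ τ ∈ T, B t τ) - Real.log S) +
        (Real.log S - Real.log (∑ τ ∈ T, B 0 τ) - (Real.log (∑ τ ∈ T, A t τ) - Real.log (∑ τ ∈ T, A 0 τ))) := by ring
  rw [e]
  exact (abs_add_le _ _).trans (add_le_add hlogB hdc)

/-- **NECESSITY OF (DC) GIVEN (RM)**: under the same response matching, the decorrelation expression is within `r` of the two-run difference of the
generating-function increments — `|(DC)-expression| ≤ |ΔgenFun| + r`.  With EXACT response matching (`r = 0`) the two coincide: GIVEN term-wise
matching of the responses, node U5's increment bound IS the decorrelation letter (sufficient by the previous theorem, necessary by this one). [folklore] -/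
theorem abs_decorrelation_le_of_genFunIncr (hT : T.Nonempty)
    (hA : ∀ t, |t| ≤ l₀ → ∀ τ ∈ T, 0 < A t τ) (hB : ∀ t, |t| ≤ l₀ → ∀ τ ∈ T, 0 < B t τ) (hl₀ : 0 ≤ l₀)
    (hRM : ∀ t, |t| ≤ l₀ → ∀ τ ∈ T,
      |(Real.log (B t τ) - Real.log (B 0 τ)) - (Real.log (A t τ) - Real.log (A 0 τ))| ≤ r)
    {t : ℝ} (ht : |t| ≤ l₀) :
    |Real.log (∑ τ ∈ T, B 0 τ * (A t τ / A 0 τ)) - Real.log (∑ τ ∈ T, B 0 τ) -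
        (Real.log (∑ τ ∈ T, A t τ) - Real.log (∑ τ ∈ T, A 0 τ))| ≤
      |(Real.log (∑ τ ∈ T, B t τ) - Real.log (∑ τ ∈ T, B 0 τ)) -
        (Real.log (∑ τ ∈ T, A t τ) - Real.log (∑ τ ∈ T, A 0 τ))| + r := by
  have h0 : |(0 : ℝ)| ≤ l₀ := by simpa using hl₀
  set S : ℝ := ∑ τ ∈ T, B 0 τ * (A t τ / A 0 τ) with hS
  have hXpos : ∀ τ ∈ T, 0 < B 0 τ * (A t τ / A 0 τ) := fun τ hτ =>
    mul_pos (hB 0 h0 τ hτ) (div_pos (hA t ht τ hτ) (hA 0 h0 τ hτ))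
  have hSpos : 0 < S := Finset.sum_pos hXpos hT
  have hterm : ∀ τ ∈ T, Real.exp (-r) * (B 0 τ * (A t τ / A 0 τ)) ≤ B t τ ∧ B t τ ≤ Real.exp r * (B 0 τ * (A t τ / A 0 τ)) := by
    intro τ hτ
    refine sandwich_of_abs_log_sub_log_le (hXpos τ hτ) (hB t ht τ hτ) ?_
    rw [Real.log_mul (hB 0 h0 τ hτ).ne' (div_pos (hA t ht τ hτ) (hA 0 h0 τ hτ)).ne', Real.log_div (hA t ht τ hτ).ne' (hA 0 h0 τ hτ).ne']
    have e : Real.log (B t τ) - (Real.log (B 0 τ) + (Real.log (A t τ) - Real.log (A 0 τ))) =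
        Real.log (B t τ) - Real.log (B 0 τ) - (Real.log (A t τ) - Real.log (A 0 τ)) := by ring
    rw [e]; exact hRM t ht τ hτ
  have hlogB : |Real.log (∑ τ ∈ T, B t τ) - Real.log S| ≤ r := abs_log_sub_log_le_of_sandwich hSpos (sum_sandwich hterm)
  have e : Real.log S - Real.log (∑ τ ∈ T, B 0 τ) - (Real.log (∑ τ ∈ T, A t τ) - Real.log (∑ τ ∈ T, A 0 τ)) =
      (Real.log (∑ τ ∈ T, B t τ) - Real.log (∑ τ ∈ T, B 0 τ) - (Real.log (∑ τ ∈ T, A t τ) - Real.log (∑ τ ∈ T, A 0 τ))) -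
        (Real.log (∑ τ ∈ T, B t τ) - Real.log S) := by ring
  rw [e]
  calc _ ≤ |Real.log (∑ τ ∈ T, B t τ) - Real.log (∑ τ ∈ T, B 0 τ) - (Real.log (∑ τ ∈ T, A t τ) - Real.log (∑ τ ∈ T, A 0 τ))| +
        |Real.log (∑ τ ∈ T, B t τ) - Real.log S| := abs_sub _ _
    _ ≤ _ := add_le_add le_rfl hlogB

end OneStep

/-! ## §2 The three sources of the decorrelation letter (DC) -/

section Sources

variable {T : Finset ι} {A B : ℝ → ι → ℝ} {l₀ : ℝ}

/-- TERMWISE ⇒ TOTAL: if `|log y τ − log x τ − φ| ≤ s` for positive terms on a nonempty `T`, then `|log Σ_T y − log Σ_T x − φ| ≤ s`. [folklore] -/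
theorem abs_log_sum_sub_log_sum_sub_le {T : Finset ι} {x y : ι → ℝ} {φ s : ℝ} (hT : T.Nonempty) (hx : ∀ τ ∈ T, 0 < x τ)
    (hy : ∀ τ ∈ T, 0 < y τ) (h : ∀ τ ∈ T, |Real.log (y τ) - Real.log (x τ) - φ| ≤ s) :
    |Real.log (∑ τ ∈ T, y τ) - Real.log (∑ τ ∈ T, x τ) - φ| ≤ s := by
  have hterm : ∀ τ ∈ T, Real.exp (-s) * (Real.exp φ * x τ) ≤ y τ ∧ y τ ≤ Real.exp s * (Real.exp φ * x τ) := by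
    intro τ hτ
    refine sandwich_of_abs_log_sub_log_le (mul_pos (Real.exp_pos _) (hx τ hτ)) (hy τ hτ) ?_
    rw [Real.log_mul (Real.exp_pos _).ne' (hx τ hτ).ne', Real.log_exp]
    have e : Real.log (y τ) - (φ + Real.log (x τ)) = Real.log (y τ) - Real.log (x τ) - φ := by ring
    rw [e]; exact h τ hτ
  have hpos : 0 < ∑ τ ∈ T, Real.exp φ * x τ := Finset.sum_pos (fun τ hτ => mul_pos (Real.exp_pos _) (hx τ hτ)) hT
  have hsum : 0 < ∑ τ ∈ T, x τ := Finset.sum_pos hx hT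
  have hlog := abs_log_sub_log_le_of_sandwich hpos (sum_sandwich hterm)
  rw [← Finset.mul_sum, Real.log_mul (Real.exp_pos _).ne' hsum.ne', Real.log_exp] at hlog
  have e : Real.log (∑ τ ∈ T, y τ) - (φ + Real.log (∑ τ ∈ T, x τ)) = Real.log (∑ τ ∈ T, y τ) - Real.log (∑ τ ∈ T, x τ) - φ := by ring
  rwa [e] at hlog

/-- **(DC) FROM A CLASS-BLIND RESPONSE** (`κ = 2s`): if run A's source response is class-blind up to `s`, `|log A_t τ − log A_0 τ − φ t| ≤ s` on `T`
(run A's class law does not feel the source), then the `ν_B`- and `ν_A`-means of the response agree up to `e^{±2s}` — WHATEVER the contrast `B_0∕A_0`,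
however large and class-dependent. [folklore] -/
theorem decorrelation_of_classBlindResponse (hT : T.Nonempty)
    (hA : ∀ t, |t| ≤ l₀ → ∀ τ ∈ T, 0 < A t τ) (hB0 : ∀ τ ∈ T, 0 < B 0 τ) (hl₀ : 0 ≤ l₀) {φ : ℝ → ℝ} {s : ℝ}
    (hCB : ∀ t, |t| ≤ l₀ → ∀ τ ∈ T, |Real.log (A t τ) - Real.log (A 0 τ) - φ t| ≤ s) {t : ℝ} (ht : |t| ≤ l₀) :
    |Real.log (∑ τ ∈ T, B 0 τ * (A t τ / A 0 τ)) - Real.log (∑ τ ∈ T, B 0 τ) -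
        (Real.log (∑ τ ∈ T, A t τ) - Real.log (∑ τ ∈ T, A 0 τ))| ≤ 2 * s := by
  have h0 : |(0 : ℝ)| ≤ l₀ := by simpa using hl₀
  -- (i) the tilted sum `Σ B_0 ρ_t` against `Σ B_0`: termwise `log (B_0 ρ_t) − log B_0 − φ t = log A_t − log A_0 − φ t`
  have h1 : |Real.log (∑ τ ∈ T, B 0 τ * (A t τ / A 0 τ)) - Real.log (∑ τ ∈ T, B 0 τ) - φ t| ≤ s := by
    refine abs_log_sum_sub_log_sum_sub_le hT hB0 (fun τ hτ => mul_pos (hB0 τ hτ) (div_pos (hA t ht τ hτ) (hA 0 h0 τ hτ))) fun τ hτ => ?_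
    rw [Real.log_mul (hB0 τ hτ).ne' (div_pos (hA t ht τ hτ) (hA 0 h0 τ hτ)).ne', Real.log_div (hA t ht τ hτ).ne' (hA 0 h0 τ hτ).ne']
    have e : Real.log (B 0 τ) + (Real.log (A t τ) - Real.log (A 0 τ)) - Real.log (B 0 τ) - φ t = Real.log (A t τ) - Real.log (A 0 τ) - φ t := by ring
    rw [e]; exact hCB t ht τ hτ
  -- (ii) run A's own sums
  have h2 : |Real.log (∑ τ ∈ T, A t τ) - Real.log (∑ τ ∈ T, A 0 τ) - φ t| ≤ s :=
    abs_log_sum_sub_log_sum_sub_le hT (fun τ hτ => hA 0 h0 τ hτ) (fun τ hτ => hA t ht τ hτ) (hCB t ht)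
  have e : Real.log (∑ τ ∈ T, B 0 τ * (A t τ / A 0 τ)) - Real.log (∑ τ ∈ T, B 0 τ) -
      (Real.log (∑ τ ∈ T, A t τ) - Real.log (∑ τ ∈ T, A 0 τ)) =
      (Real.log (∑ τ ∈ T, B 0 τ * (A t τ / A 0 τ)) - Real.log (∑ τ ∈ T, B 0 τ) - φ t) -
        (Real.log (∑ τ ∈ T, A t τ) - Real.log (∑ τ ∈ T, A 0 τ) - φ t) := by ring
  rw [e]
  calc _ ≤ |Real.log (∑ τ ∈ T, B 0 τ * (A t τ / A 0 τ)) - Real.log (∑ τ ∈ T, B 0 τ) - φ t| +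
        |Real.log (∑ τ ∈ T, A t τ) - Real.log (∑ τ ∈ T, A 0 τ) - φ t| := abs_sub _ _
    _ ≤ s + s := add_le_add h1 h2
    _ = 2 * s := by ring

/-- **(DC) FROM A CLASS-BLIND CONTRAST** (`κ = 2η`) — the `Core` road: if the two-run source-free contrast is class-blind up to `η`,
`|log B_0 τ − log A_0 τ − c| ≤ η` on `T` (ONE constant `c` — `Core`'s), then (DC) holds with `κ = 2η`, WHATEVER the response. [folklore] -/
theorem decorrelation_of_classBlindContrast (hT : T.Nonempty)
    (hA : ∀ t, |t| ≤ l₀ → ∀ τ ∈ T, 0 < A t τ) (hB0 : ∀ τ ∈ T, 0 < B 0 τ) (hl₀ : 0 ≤ l₀) {c η : ℝ}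
    (hCC : ∀ τ ∈ T, |Real.log (B 0 τ) - Real.log (A 0 τ) - c| ≤ η) {t : ℝ} (ht : |t| ≤ l₀) :
    |Real.log (∑ τ ∈ T, B 0 τ * (A t τ / A 0 τ)) - Real.log (∑ τ ∈ T, B 0 τ) -
        (Real.log (∑ τ ∈ T, A t τ) - Real.log (∑ τ ∈ T, A 0 τ))| ≤ 2 * η := by
  have h0 : |(0 : ℝ)| ≤ l₀ := by simpa using hl₀
  -- (i) `Σ B_0 ρ_t` against `Σ A_t`: termwise `log (B_0 A_t/A_0) − log A_t − c = log B_0 − log A_0 − c`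
  have h1 : |Real.log (∑ τ ∈ T, B 0 τ * (A t τ / A 0 τ)) - Real.log (∑ τ ∈ T, A t τ) - c| ≤ η := by
    refine abs_log_sum_sub_log_sum_sub_le hT (fun τ hτ => hA t ht τ hτ)
      (fun τ hτ => mul_pos (hB0 τ hτ) (div_pos (hA t ht τ hτ) (hA 0 h0 τ hτ))) fun τ hτ => ?_
    rw [Real.log_mul (hB0 τ hτ).ne' (div_pos (hA t ht τ hτ) (hA 0 h0 τ hτ)).ne', Real.log_div (hA t ht τ hτ).ne' (hA 0 h0 τ hτ).ne']
    have e : Real.log (B 0 τ) + (Real.log (A t τ) - Real.log (A 0 τ)) - Real.log (A t τ) - c = Real.log (B 0 τ) - Real.log (A 0 τ) - c := by ring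
    rw [e]; exact hCC τ hτ
  -- (ii) `Σ B_0` against `Σ A_0`
  have h2 : |Real.log (∑ τ ∈ T, B 0 τ) - Real.log (∑ τ ∈ T, A 0 τ) - c| ≤ η :=
    abs_log_sum_sub_log_sum_sub_le hT (fun τ hτ => hA 0 h0 τ hτ) hB0 hCC
  have e : Real.log (∑ τ ∈ T, B 0 τ * (A t τ / A 0 τ)) - Real.log (∑ τ ∈ T, B 0 τ) -
      (Real.log (∑ τ ∈ T, A t τ) - Real.log (∑ τ ∈ T, A 0 τ)) =
      (Real.log (∑ τ ∈ T, B 0 τ * (A t τ / A 0 τ)) - Real.log (∑ τ ∈ T, A t τ) - c) -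
        (Real.log (∑ τ ∈ T, B 0 τ) - Real.log (∑ τ ∈ T, A 0 τ) - c) := by ring
  rw [e]
  calc _ ≤ |Real.log (∑ τ ∈ T, B 0 τ * (A t τ / A 0 τ)) - Real.log (∑ τ ∈ T, A t τ) - c| +
        |Real.log (∑ τ ∈ T, B 0 τ) - Real.log (∑ τ ∈ T, A 0 τ) - c| := abs_sub _ _
    _ ≤ η + η := add_le_add h1 h2
    _ = 2 * η := by ring


/-- **(DC) EXACTLY FROM AN OLD ∕ RECENT PRODUCT STRUCTURE** (`κ = 0`): classes `T₁ ×ˢ T₂` (old coordinate × recent coordinate), run A's source-free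
class law a PRODUCT `A_0 (τ₁, τ₂) = a₁ τ₁ · a₂ τ₂`, the two-run contrast reading the OLD coordinate only (`B_0 = u τ₁ · A_0`) and run A's source response
the RECENT coordinate only (`A_t = A_0 · v_t τ₂`, `v_t > 0`, `v_0 = 1`): then the `ν_B`- and `ν_A`-means of the response COINCIDE — however large, class-dependent and
law-separating the contrast `u`.  (The algebra: both sides equal `log Σ_{T₂} a₂ v_t − log Σ_{T₂} a₂`.) [folklore] -/
theorem decorrelation_of_product {ι₁ ι₂ : Type*} {T₁ : Finset ι₁} {T₂ : Finset ι₂} {a₁ u : ι₁ → ℝ} {a₂ : ι₂ → ℝ} {v : ℝ → ι₂ → ℝ}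
    {A B : ℝ → ι₁ × ι₂ → ℝ} (ha₁ : ∀ τ₁ ∈ T₁, 0 < a₁ τ₁) (hu : ∀ τ₁ ∈ T₁, 0 < u τ₁) (ha₂ : ∀ τ₂ ∈ T₂, 0 < a₂ τ₂)
    (hT₁ : T₁.Nonempty) (hT₂ : T₂.Nonempty) (hv : ∀ t, ∀ τ₂ ∈ T₂, 0 < v t τ₂)
    (hA : ∀ t (τ : ι₁ × ι₂), τ ∈ T₁ ×ˢ T₂ → A t τ = a₁ τ.1 * a₂ τ.2 * v t τ.2) (hv0 : ∀ τ₂ ∈ T₂, v 0 τ₂ = 1)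
    (hB0 : ∀ τ : ι₁ × ι₂, τ ∈ T₁ ×ˢ T₂ → B 0 τ = u τ.1 * (a₁ τ.1 * a₂ τ.2)) (t : ℝ) :
    Real.log (∑ τ ∈ T₁ ×ˢ T₂, B 0 τ * (A t τ / A 0 τ)) - Real.log (∑ τ ∈ T₁ ×ˢ T₂, B 0 τ) -
        (Real.log (∑ τ ∈ T₁ ×ˢ T₂, A t τ) - Real.log (∑ τ ∈ T₁ ×ˢ T₂, A 0 τ)) = 0 := by
  -- the four sums factor
  have hS : ∑ τ ∈ T₁ ×ˢ T₂, B 0 τ * (A t τ / A 0 τ) = (∑ τ₁ ∈ T₁, u τ₁ * a₁ τ₁) * ∑ τ₂ ∈ T₂, a₂ τ₂ * v t τ₂ := by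
    rw [Finset.sum_product, Finset.sum_mul]
    refine Finset.sum_congr rfl fun τ₁ hτ₁ => ?_
    rw [Finset.mul_sum]
    refine Finset.sum_congr rfl fun τ₂ hτ₂ => ?_
    have hmem : (τ₁, τ₂) ∈ T₁ ×ˢ T₂ := Finset.mem_product.2 ⟨hτ₁, hτ₂⟩
    rw [hB0 _ hmem, hA t _ hmem, hA 0 _ hmem, hv0 τ₂ hτ₂]
    have h1 := (ha₁ τ₁ hτ₁).ne'
    have h2 := (ha₂ τ₂ hτ₂).ne'
    field_simp
  have hB : ∑ τ ∈ T₁ ×ˢ T₂, B 0 τ = (∑ τ₁ ∈ T₁, u τ₁ * a₁ τ₁) * ∑ τ₂ ∈ T₂, a₂ τ₂ := by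
    rw [Finset.sum_product, Finset.sum_mul]
    refine Finset.sum_congr rfl fun τ₁ hτ₁ => ?_
    rw [Finset.mul_sum]
    refine Finset.sum_congr rfl fun τ₂ hτ₂ => ?_
    rw [hB0 _ (Finset.mem_product.2 ⟨hτ₁, hτ₂⟩)]
    ring
  have hAt : ∑ τ ∈ T₁ ×ˢ T₂, A t τ = (∑ τ₁ ∈ T₁, a₁ τ₁) * ∑ τ₂ ∈ T₂, a₂ τ₂ * v t τ₂ := by
    rw [Finset.sum_product, Finset.sum_mul]
    refine Finset.sum_congr rfl fun τ₁ hτ₁ => ?_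
    rw [Finset.mul_sum]
    refine Finset.sum_congr rfl fun τ₂ hτ₂ => ?_
    rw [hA t _ (Finset.mem_product.2 ⟨hτ₁, hτ₂⟩)]
    ring
  have hA0 : ∑ τ ∈ T₁ ×ˢ T₂, A 0 τ = (∑ τ₁ ∈ T₁, a₁ τ₁) * ∑ τ₂ ∈ T₂, a₂ τ₂ := by
    rw [Finset.sum_product, Finset.sum_mul]
    refine Finset.sum_congr rfl fun τ₁ hτ₁ => ?_
    rw [Finset.mul_sum]
    refine Finset.sum_congr rfl fun τ₂ hτ₂ => ?_
    rw [hA 0 _ (Finset.mem_product.2 ⟨hτ₁, hτ₂⟩), hv0 τ₂ hτ₂]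
    ring
  rw [hS, hB, hAt, hA0]
  have hx : 0 < ∑ τ₁ ∈ T₁, u τ₁ * a₁ τ₁ := Finset.sum_pos (fun τ₁ h => mul_pos (hu τ₁ h) (ha₁ τ₁ h)) hT₁
  have hx' : 0 < ∑ τ₁ ∈ T₁, a₁ τ₁ := Finset.sum_pos ha₁ hT₁
  have hy : 0 < ∑ τ₂ ∈ T₂, a₂ τ₂ * v t τ₂ := Finset.sum_pos (fun τ₂ h => mul_pos (ha₂ τ₂ h) (hv t τ₂ h)) hT₂
  have hy' : 0 < ∑ τ₂ ∈ T₂, a₂ τ₂ := Finset.sum_pos ha₂ hT₂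
  rw [Real.log_mul hx.ne' hy.ne', Real.log_mul hx.ne' hy'.ne', Real.log_mul hx'.ne' hy.ne', Real.log_mul hx'.ne' hy'.ne']
  ring

end Sources

/-! ## §3 ALONG `K`: the response-matching ∕ decorrelation reading ⇒ `MatchingModConstants` (canonical constants) ⇒ `Target` -/

section AlongK

variable {vol l₀ : ℝ} {δ : ℕ → ℝ} {Z : ℕ → ℝ → ℝ}

/-- **`MatchingModConstants` FROM A RESPONSE-MATCHING ∕ DECORRELATION READING.**  ONE sequence `Z` READ on `|t| ≤ l₀` through the dictionary
`Z K t = Σ_{T K} A K t`, `Z (K+1) t = Σ_{T K} B K t` (E1∕E2 of `T4MatchingAssembly`), positive class weights, (RM)_K with radius `r K`, (DC)_K with radius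
`κ K`, `r K + κ K ≤ vol·δ K` ⇒ `MatchingModConstants vol l₀ δ Z` with the CANONICAL constants `log Z_{K+1}(0) − log Z_K(0)`
(`N19CoreMetric.matchingModConstants_of_genFun_increments` BY NAME).  No class-uniform constant is asked at any `K`. [folklore] -/
theorem matchingModConstants_of_responseDecorrelationReading (hl₀ : 0 ≤ l₀) (T : ℕ → Finset ι) (A B : ℕ → ℝ → ι → ℝ) (r κ : ℕ → ℝ)
    (hT : ∀ K, (T K).Nonempty) (hA : ∀ K t, |t| ≤ l₀ → ∀ τ ∈ T K, 0 < A K t τ) (hB : ∀ K t, |t| ≤ l₀ → ∀ τ ∈ T K, 0 < B K t τ)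
    (hRM : ∀ K t, |t| ≤ l₀ → ∀ τ ∈ T K,
      |(Real.log (B K t τ) - Real.log (B K 0 τ)) - (Real.log (A K t τ) - Real.log (A K 0 τ))| ≤ r K)
    (hDC : ∀ K t, |t| ≤ l₀ →
      |Real.log (∑ τ ∈ T K, B K 0 τ * (A K t τ / A K 0 τ)) - Real.log (∑ τ ∈ T K, B K 0 τ) -
        (Real.log (∑ τ ∈ T K, A K t τ) - Real.log (∑ τ ∈ T K, A K 0 τ))| ≤ κ K)
    (hZA : ∀ K t, |t| ≤ l₀ → Z K t = ∑ τ ∈ T K, A K t τ) (hZB : ∀ K t, |t| ≤ l₀ → Z (K + 1) t = ∑ τ ∈ T K, B K t τ)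
    (hbud : ∀ K, r K + κ K ≤ vol * δ K) :
    MatchingModConstants vol l₀ δ Z := by
  have h0 : |(0 : ℝ)| ≤ l₀ := by simpa using hl₀
  refine matchingModConstants_of_genFun_increments fun K t ht => ?_
  simp only [genFun]
  rw [hZB K t ht, hZB K 0 h0, hZA K t ht, hZA K 0 h0]
  exact (abs_genFunIncr_sub_le_of_response_decorrelation (hT K) (hA K) (hB K) hl₀ (hRM K) (hDC K) ht).trans (hbud K)

/-- **NODE U5's `Target` FROM A RESPONSE-MATCHING ∕ DECORRELATION READING**: the previous theorem with a summable budget. [folklore] -/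
theorem target_of_responseDecorrelationReading (hl₀ : 0 ≤ l₀) (T : ℕ → Finset ι) (A B : ℕ → ℝ → ι → ℝ) (r κ : ℕ → ℝ)
    (hT : ∀ K, (T K).Nonempty) (hA : ∀ K t, |t| ≤ l₀ → ∀ τ ∈ T K, 0 < A K t τ) (hB : ∀ K t, |t| ≤ l₀ → ∀ τ ∈ T K, 0 < B K t τ)
    (hRM : ∀ K t, |t| ≤ l₀ → ∀ τ ∈ T K,
      |(Real.log (B K t τ) - Real.log (B K 0 τ)) - (Real.log (A K t τ) - Real.log (A K 0 τ))| ≤ r K)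
    (hDC : ∀ K t, |t| ≤ l₀ →
      |Real.log (∑ τ ∈ T K, B K 0 τ * (A K t τ / A K 0 τ)) - Real.log (∑ τ ∈ T K, B K 0 τ) -
        (Real.log (∑ τ ∈ T K, A K t τ) - Real.log (∑ τ ∈ T K, A K 0 τ))| ≤ κ K)
    (hZA : ∀ K t, |t| ≤ l₀ → Z K t = ∑ τ ∈ T K, A K t τ) (hZB : ∀ K t, |t| ≤ l₀ → Z (K + 1) t = ∑ τ ∈ T K, B K t τ)
    (hbud : ∀ K, r K + κ K ≤ vol * δ K) (hδ : Summable δ) : NE7.Target vol l₀ δ Z :=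
  ⟨matchingModConstants_of_responseDecorrelationReading hl₀ T A B r κ hT hA hB hRM hDC hZA hZB hbud, hδ⟩

end AlongK


end Summit.QuantumFields.YangMills.BalabanUVNodes.N19TargetOfDecorrelationReading

end
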